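import Literature.AnabelianGeometry.EtaleTheta.ThetaRigidity
import Mathlib.Algebra.Group.PUnit
import Mathlib.Algebra.Group.TypeTags.Finite
import Mathlib.Data.ZMod.Basic
import Mathlib.Topology.Instances.ZMod
import Mathlib.GroupTheory.SpecificGroups.Cyclic.Basic
import HarnessLib

/-!
# A degenerate model of the [EtTh] §2 interface `RigidData` (level `N = 1`)

`ThetaRigidity.lean` (cell `abc-iut`, seat abc-iut-L2-t2) types S. Mochizuki, *The Étale Theta Function …*
[EtTh] §2 (Prop. 2.12, 2.14, Cor. 2.18, 2.19 (i); PRIMS pp. 45–65) as `Prop`-valued definitions over the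
interface `RigidData N l` (= `ThetaEnvData` + theta subquotients + labelled cusps), which records the DATA
named in print with the quoted bookkeeping axioms (normality, openness, `[Π^tp_Y : Π^tp_Ÿ] = 2`,
`(l·Δ_Θ) ⊗ ℤ/N ≅ μ_N`, `K^×,(l·ℤ)`-conjugacy of theta sections) but none of the anabelian content
(temp-slimness, characteristic subgroups, the structure of `D_Y`).  This file builds an explicit
INHABITANT of the interface in which that content fails, consumed by `ThetaRigiditySchemaWitness.lean`:
`RigidData.Toy.toy l : RigidData 1 l` — `Π^tp_X := ℤ × (ℤ/2)³` discrete abelian, `G_K := 1`, `μ_1 := 1`,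
`Π^tp_Y := 0 × (ℤ/2)³`, `Π^tp_Ÿ := {a = 0}`, `(l·Δ_Θ) :=` the `c`-axis, `Ker(Π ↠ Π^Θ) := 1`, theta
cocycles `{1}`, cusps of `Y`: `{⊥}` at label `0` and `∅` elsewhere, no cusps of `X` (EVERY interface axiom
holds); plus the coordinate involutions `swapAB`, `swapBC` of `(ℤ/2)³` and the induced automorphisms
`autP` of `Π^tp_X`, `autY`/`autYCont` of `Π^tp_Y`, `autEnv` of the envelope `Π^tp_Y[μ_1]` (`D_Y = 1` there:
`DY_eq_bot`).  Honest framing: a toy of a lawless interface; nothing here is a statement about [EtTh]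
(refereed) or about the genuine model of lane C2 (`Discharge/Sec2Cor218i*`, …).  Written by the cell
`abc-iut` (seat abc-iut-w5-d175; F-TRANCHES 146–149/183 of D-0078 (S1)).  No side taken on [IUTchIII]
Cor. 3.12; typed ≠ proved.  No instances, no notation.

Reference: [MochizukiEtTh2009] S. Mochizuki, *The étale theta function and its Frobenioid-theoretic
manifestations*, Publ. RIMS 45 (2009): Def. 2.10 p.44, Def. 2.13 pp.47–48, Prop. 2.12 p.45, Prop. 2.14
p.49, Cor. 2.18 pp.59–62 (PRIMS text pages).
-/

namespace Literature.AnabelianGeometry.EtaleTheta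

namespace RigidData

namespace Toy

/-! ## §0. Cyclotomic envelopes with TRIVIAL cyclotome over an ABELIAN group -/

section Generic

variable {P G μ : Type*} [CommGroup P] [Group G] [CommGroup μ] [Subsingleton μ]
  (aug : P →* G) (χ : G →* MulAut μ)

/-- With `μ` trivial and `Π` abelian, `Π[μ]` is commutative. [cite: MochizukiEtTh2009, Def 2.10 p.44] -/
theorem env_mul_comm (x y : CycEnvelope aug χ) : x * y = y * x := by
  ext
  · exact Subsingleton.elim _ _
  · simp only [SemidirectProduct.mul_right, mul_comm]

/-- With `μ` trivial and `Π` abelian, every inner automorphism of `Π[μ]` is the identity.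
[cite: MochizukiEtTh2009, Def 2.13(i) p.47] -/
theorem conj_env_eq_one (z : CycEnvelope aug χ) : MulAut.conj z = 1 := by
  refine MulEquiv.ext fun x => ?_
  rw [MulAut.conj_apply, env_mul_comm aug χ z x, mul_inv_cancel_right]
  rfl

/-- With `μ` trivial, the kernel of `Π[μ] ↠ Π` is trivial. [cite: MochizukiEtTh2009, Def 2.10 p.44] -/
theorem ker_proj_eq_bot : (CycEnvelope.proj aug χ).ker = ⊥ := by
  refine (Subgroup.eq_bot_iff_forall _).mpr fun x hx => ?_
  rw [MonoidHom.mem_ker] at hx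
  ext
  · exact Subsingleton.elim _ _
  · exact hx

/-- With `μ` trivial, a `μ`-conjugacy class of subgroups is a singleton.
[cite: MochizukiEtTh2009, Def 2.10 p.44] -/
theorem muConjClass_eq_singleton (H : Subgroup (CycEnvelope aug χ)) :
    CycEnvelope.muConjClass aug χ H = {H} := by
  ext K
  simp only [CycEnvelope.muConjClass, Set.mem_setOf_eq, Set.mem_singleton_iff]
  have h1 : ∀ a : μ, (MulAut.conj (CycEnvelope.inMu aug χ a)).toMonoidHom = MonoidHom.id _ := by
    intro a
    rw [Subsingleton.elim a 1, map_one, map_one]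
    rfl
  constructor
  · rintro ⟨a, rfl⟩
    rw [h1, Subgroup.map_id]
  · rintro rfl
    exact ⟨1, by rw [h1, Subgroup.map_id]⟩

/-- With `μ` trivial, every cocycle shift `α_δ` of `Π[μ]` is the identity.
[cite: MochizukiEtTh2009, Prop 2.14(ii) p.49] -/
theorem shift_eq_one {δ : P → μ} (hδ : CycEnvelope.IsEnvCocycle aug χ δ) :
    CycEnvelope.shift hδ = 1 := by
  ext x
  · exact Subsingleton.elim _ _
  · rfl

end Generic

/-! ## §1. The toy `RigidData` at level `N = 1` -/

/-- `ℤ/2` written multiplicatively. [cite: MochizukiEtTh2009, Cor 2.18 p.59] -/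
abbrev M2 : Type := Multiplicative (ZMod 2)

/-- `K := (ℤ/2)³`, coordinates `(a, (b, c))`. [cite: MochizukiEtTh2009, Cor 2.18 p.59] -/
abbrev K : Type := M2 × (M2 × M2)

/-- The toy `Π^tp_X := ℤ × (ℤ/2)³` (discrete, abelian). [cite: MochizukiEtTh2009, Cor 2.18 p.59] -/
abbrev P : Type := Multiplicative ℤ × K

/-- The generator of `ℤ/2`. [cite: MochizukiEtTh2009, Cor 2.18 p.59] -/
abbrev g : M2 := Multiplicative.ofAdd 1

/-- `g ≠ 1` in `ℤ/2`. [cite: MochizukiEtTh2009, Cor 2.18 p.59] -/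
theorem g_ne_one : g ≠ 1 := by decide

/-- The `a`-coordinate `Π → ℤ/2`. [cite: MochizukiEtTh2009, Cor 2.18 p.59] -/
def pa : P →* M2 := (MonoidHom.fst M2 (M2 × M2)).comp (MonoidHom.snd (Multiplicative ℤ) K)

/-- The `b`-coordinate `Π → ℤ/2`. [cite: MochizukiEtTh2009, Cor 2.18 p.59] -/
def pb : P →* M2 :=
  (MonoidHom.fst M2 M2).comp ((MonoidHom.snd M2 (M2 × M2)).comp (MonoidHom.snd (Multiplicative ℤ) K))

/-- `pa` on a tuple. [cite: MochizukiEtTh2009, Cor 2.18 p.59] -/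
@[simp] theorem pa_apply (z : Multiplicative ℤ) (a b c : M2) : pa (z, (a, (b, c))) = a := rfl

/-- `pb` on a tuple. [cite: MochizukiEtTh2009, Cor 2.18 p.59] -/
@[simp] theorem pb_apply (z : Multiplicative ℤ) (a b c : M2) : pb (z, (a, (b, c))) = b := rfl

/-- `Π^tp_Y := 0 × (ℤ/2)³ = Ker(Π ↠ ℤ)`. [cite: MochizukiEtTh2009, Def 2.13 p.47] -/
abbrev PiY : Subgroup P := (MonoidHom.fst (Multiplicative ℤ) K).ker

/-- `Π^tp_Ÿ := {a = 0} ∩ Π^tp_Y`. [cite: MochizukiEtTh2009, Def 2.13 p.47] -/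
abbrev PiYdd : Subgroup P := pa.ker ⊓ PiY

/-- `(l·Δ_Θ) :=` the `c`-axis `{a = b = 0} ∩ Π^tp_Y`. [cite: MochizukiEtTh2009, Prop 2.12 p.45] -/
abbrev L : Subgroup P := (pa.ker ⊓ pb.ker) ⊓ PiY

/-- Membership in `Π^tp_Y`. [cite: MochizukiEtTh2009, Def 2.13 p.47] -/
theorem mem_PiY_iff (z : Multiplicative ℤ) (k : K) : ((z, k) : P) ∈ PiY ↔ z = 1 := by
  simp [Subgroup.mem_prod, Subgroup.mem_bot]

/-- Membership in `Π^tp_Ÿ`. [cite: MochizukiEtTh2009, Def 2.13 p.47] -/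
theorem mem_PiYdd_iff (z : Multiplicative ℤ) (a b c : M2) :
    ((z, (a, (b, c))) : P) ∈ PiYdd ↔ a = 1 ∧ z = 1 := by
  simp [Subgroup.mem_inf, MonoidHom.mem_ker, Subgroup.mem_prod, Subgroup.mem_bot]

/-- Membership in `(l·Δ_Θ)`. [cite: MochizukiEtTh2009, Prop 2.12 p.45] -/
theorem mem_L_iff (z : Multiplicative ℤ) (a b c : M2) :
    ((z, (a, (b, c))) : P) ∈ L ↔ (a = 1 ∧ b = 1) ∧ z = 1 := by
  simp [Subgroup.mem_inf, MonoidHom.mem_ker, Subgroup.mem_prod, Subgroup.mem_bot]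

/-- Membership in `Π^tp_Y`, general element. [cite: MochizukiEtTh2009, Def 2.13 p.47] -/
theorem mem_PiY_iff' (x : P) : x ∈ PiY ↔ x.1 = 1 := by
  obtain ⟨z, k⟩ := x
  exact mem_PiY_iff z k

/-- Membership in `Π^tp_Ÿ`, general element. [cite: MochizukiEtTh2009, Def 2.13 p.47] -/
theorem mem_PiYdd_iff' (x : P) : x ∈ PiYdd ↔ x.2.1 = 1 ∧ x.1 = 1 := by
  obtain ⟨z, a, b, c⟩ := x
  exact mem_PiYdd_iff z a b c

/-- `[Π^tp_Y : Π^tp_Ÿ] = 2` at the toy. [cite: MochizukiEtTh2009, Def 2.13 p.47] -/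
theorem index_PiYdd : (PiYdd.subgroupOf PiY).index = 2 := by
  change PiYdd.relIndex PiY = 2
  rw [Subgroup.inf_relIndex_right, Subgroup.relIndex_ker]
  have hmap : PiY.map pa = ⊤ := by
    refine top_le_iff.mp fun a _ => ?_
    exact ⟨(1, (a, (1, 1))), by simp [Subgroup.mem_prod], rfl⟩
  rw [hmap, Subgroup.card_top, Nat.card_eq_fintype_card]
  rfl

/-- **The toy `RigidData`** at level `N = 1` (for any `l`): `Π^tp_X = ℤ × (ℤ/2)³` discrete abelian,
`G_K = μ_1 = 1`, `Π^tp_Y = 0 × (ℤ/2)³`, `Π^tp_Ÿ = {a = 0}`, `(l·Δ_Θ) = c`-axis, `Ker(Π ↠ Π^Θ) = 1`,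
theta cocycles `{1}`, cusps of `Y`: `{⊥}` at label `0`, none elsewhere; no cusps of `X`.  Every axiom of
the interface is satisfied. [cite: MochizukiEtTh2009, Cor 2.18 p.59] -/
@[reducible] noncomputable def toy (l : ℕ) : RigidData.{0} 1 l where
  PiX := P
  G := PUnit
  aug := 1
  aug_surjective := fun _ => ⟨1, Subsingleton.elim _ _⟩
  PiY := PiY
  PiY_normal := inferInstance
  PiY_open := isOpen_discrete _
  galYX := QuotientGroup.quotientKerEquivOfSurjective (MonoidHom.fst (Multiplicative ℤ) K)
    (fun z => ⟨(z, 1), rfl⟩)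
  PiYdd := PiYdd
  PiYdd_le := inf_le_right
  PiYdd_normal := inferInstance
  PiYdd_open := isOpen_discrete _
  index_PiYdd := index_PiYdd
  mu := PUnit
  mu_cyclic := isCyclic_of_subsingleton
  card_mu := by simp
  chi := 1
  chi_ker_open := isOpen_discrete _
  thetaCocycles := {1}
  thetaCocycles_nonempty := Set.singleton_nonempty _
  isCocycle := fun _ _ _ _ => Subsingleton.elim _ _
  locallyConstant := fun η _ => IsLocallyConstant.of_discrete η
  mul_coboundary_mem := fun η _ c => by
    rw [Set.mem_singleton_iff]
    exact funext fun _ => Subsingleton.elim _ _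
  thetaKer := ⊥
  thetaKer_normal := inferInstance
  thetaKer_le := bot_le
  lDeltaTheta := L
  thetaKer_le_lDeltaTheta := bot_le
  lDeltaTheta_le := by
    rw [MonoidHom.ker_one]
    exact le_inf (inf_le_inf_right _ inf_le_left) le_top
  lDeltaTheta_normal := inferInstance
  thetaMod := 1
  thetaMod_surjective := fun _ => ⟨1, Subsingleton.elim _ _⟩
  thetaMod_ker := fun x => ⟨fun _ => ⟨1, Subgroup.one_mem _, x, by simp⟩, fun _ => rfl⟩
  thetaMod_conj := fun _ _ => Subsingleton.elim _ _
  cocycle_thetaKer := fun _ _ _ _ => Subsingleton.elim _ _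
  cocycle_lDeltaTheta := fun _ _ _ _ => Subsingleton.elim _ _
  cuspY := fun n => if n = 0 then {⊥} else ∅
  cuspX := fun _ => ∅
  cuspX_neg := fun _ => rfl
  augYdd_surjective := fun _ => ⟨1, Subsingleton.elim _ _⟩
  thetaSections_conj := by
    intro η η' hη hη'
    have h1 : η = 1 := hη
    have h2 : η' = 1 := hη'
    subst h1 h2
    exact ThetaEnvData.IsKLConjugate.base

/-! ## §2. Elements, automorphisms, and the model environment of the toy -/

/-- The `a`-axis generator: in `Π^tp_Y`, not in `Π^tp_Ÿ`. [cite: MochizukiEtTh2009, Cor 2.18 p.59] -/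
abbrev xa : P := (1, (g, (1, 1)))

/-- The `b`-axis generator: in `Π^tp_Ÿ`, not in `(l·Δ_Θ)`. [cite: MochizukiEtTh2009, Cor 2.18 p.59] -/
abbrev xb : P := (1, (1, (g, 1)))

/-- The `c`-axis generator: generates `(l·Δ_Θ)`. [cite: MochizukiEtTh2009, Cor 2.18 p.59] -/
abbrev xc : P := (1, (1, (1, g)))

/-- `xa ∉ Π^tp_Ÿ`. [cite: MochizukiEtTh2009, Cor 2.18 p.59] -/
theorem xa_not_mem_PiYdd : xa ∉ PiYdd := fun h => g_ne_one ((mem_PiYdd_iff _ _ _ _).mp h).1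

/-- `xb ∈ Π^tp_Ÿ`. [cite: MochizukiEtTh2009, Cor 2.18 p.59] -/
theorem xb_mem_PiYdd : xb ∈ PiYdd := (mem_PiYdd_iff _ _ _ _).mpr ⟨rfl, rfl⟩

/-- `xb ∉ (l·Δ_Θ)`. [cite: MochizukiEtTh2009, Cor 2.18 p.59] -/
theorem xb_not_mem_L : xb ∉ L := fun h => g_ne_one ((mem_L_iff _ _ _ _).mp h).1.2

/-- `xc ∈ Π^tp_Ÿ`. [cite: MochizukiEtTh2009, Cor 2.18 p.59] -/
theorem xc_mem_PiYdd : xc ∈ PiYdd := (mem_PiYdd_iff _ _ _ _).mpr ⟨rfl, rfl⟩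

/-- `xc ∈ (l·Δ_Θ)`. [cite: MochizukiEtTh2009, Cor 2.18 p.59] -/
theorem xc_mem_L : xc ∈ L := (mem_L_iff _ _ _ _).mpr ⟨⟨rfl, rfl⟩, rfl⟩

/-- `xb ≠ xc`. [cite: MochizukiEtTh2009, Cor 2.18 p.59] -/
theorem xb_ne_xc : xb ≠ xc := fun h => g_ne_one (by simpa using congrArg (fun x : P => x.2.2.1) h)

/-- `xa ≠ 1`. [cite: MochizukiEtTh2009, Cor 2.18 p.59] -/
theorem xa_ne_one : xa ≠ 1 := fun h => g_ne_one (by simpa using congrArg (fun x : P => x.2.1) h)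

/-- `xc ≠ 1`. [cite: MochizukiEtTh2009, Cor 2.18 p.59] -/
theorem xc_ne_one : xc ≠ 1 := fun h => g_ne_one (by simpa using congrArg (fun x : P => x.2.2.2) h)

/-- Swap of the `a`- and `b`-coordinates of `K = (ℤ/2)³`. [cite: MochizukiEtTh2009, Cor 2.18 p.59] -/
def swapAB : K ≃* K :=
  (MulEquiv.prodAssoc.symm.trans (MulEquiv.prodCongr MulEquiv.prodComm (MulEquiv.refl M2))).trans
    MulEquiv.prodAssoc

/-- Swap of the `b`- and `c`-coordinates of `K = (ℤ/2)³`. [cite: MochizukiEtTh2009, Cor 2.18 p.59] -/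
def swapBC : K ≃* K := MulEquiv.prodCongr (MulEquiv.refl M2) MulEquiv.prodComm

/-- An automorphism of `K` extended by the identity on `ℤ` to `Π = ℤ × K`, as an automorphism of the
(discrete) topological group `Π`. [cite: MochizukiEtTh2009, Cor 2.18(i) p.60] -/
def autP (σ : K ≃* K) : P ≃ₜ* P :=
  { MulEquiv.prodCongr (MulEquiv.refl (Multiplicative ℤ)) σ with
    continuous_toFun := continuous_of_discreteTopology
    continuous_invFun := continuous_of_discreteTopology }

/-- `autP σ` preserves `Π^tp_Y`. [cite: MochizukiEtTh2009, Cor 2.18(i) p.60] -/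
theorem map_autP_PiY (σ : K ≃* K) : PiY.map (autP σ).toMulEquiv.toMonoidHom = PiY := by
  ext x
  constructor
  · rintro ⟨y, hy, rfl⟩
    exact (mem_PiY_iff' _).mpr ((mem_PiY_iff' y).mp hy)
  · intro hx
    exact ⟨(autP σ).symm x, (mem_PiY_iff' _).mpr ((mem_PiY_iff' x).mp hx),
      (autP σ).apply_symm_apply x⟩

/-- The level-`1` toy has exactly one theta cocycle, `1`. [cite: MochizukiEtTh2009, Def 2.13 p.47] -/
theorem one_mem_thetaCocycles (l : ℕ) : (1 : (toy l).PiYdd → (toy l).mu) ∈ (toy l).thetaCocycles :=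
  rfl

/-- The envelope `Π^tp_Y[μ_1]` of the toy is discrete (a theorem, not an instance).
[cite: MochizukiEtTh2009, Def 2.13(ii) p.47] -/
theorem discreteTopology_env (l : ℕ) : DiscreteTopology (toy l).env :=
  DiscreteTopology.of_continuous_injective
    (f := fun x : (toy l).env => (x.left, x.right)) continuous_induced_dom
    (fun x y h => by
      obtain ⟨h1, h2⟩ := Prod.mk.inj h
      exact SemidirectProduct.ext h1 h2)

/-- The outer automorphism of `Π^tp_Y[μ_1]` induced by conjugation by an element of the (abelian) toy
`Π^tp_X` is trivial. [cite: MochizukiEtTh2009, Def 2.13(i) p.47] -/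
theorem conjX_eq_one (l : ℕ) (x : (toy l).PiX) : (toy l).toThetaEnvData.conjX x = 1 := by
  refine MulEquiv.ext fun y => SemidirectProduct.ext (Subsingleton.elim _ _) (Subtype.ext ?_)
  change x * (y.right : P) * x⁻¹ = (y.right : P)
  rw [mul_comm x, mul_inv_cancel_right]

/-- `D_Y = 1` at the toy: both the Kummer shifts and the `Gal(Y/X)`-conjugations are trivial.
[cite: MochizukiEtTh2009, Def 2.13(i) p.47] -/
theorem DY_eq_bot (l : ℕ) : (toy l).DY = ⊥ := by
  refine (Subgroup.closure_eq_bot_iff).mpr ?_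
  rintro x (⟨δ, hδ, hc, rfl⟩ | ⟨y, hc, rfl⟩)
  · rw [Set.mem_singleton_iff]
    have h1 : (⟨CycEnvelope.shift hδ, hc⟩ : contMulAut (toy l).env) = 1 :=
      Subtype.ext (shift_eq_one _ _ hδ)
    rw [h1, map_one]
  · rw [Set.mem_singleton_iff]
    have h1 : (⟨(toy l).toThetaEnvData.conjX y, hc⟩ : contMulAut (toy l).env) = 1 :=
      Subtype.ext (conjX_eq_one l y)
    rw [h1, map_one]

/-- The automorphism of the toy `Π^tp_Y` induced by `autP σ`. [cite: MochizukiEtTh2009, Cor 2.18(iv) p.61] -/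
noncomputable def autY (σ : K ≃* K) : (toy 1).PiY ≃* (toy 1).PiY :=
  ((autP σ).toMulEquiv.subgroupMap PiY).trans (MulEquiv.subgroupCongr (map_autP_PiY σ))

/-- `autY σ`, as an automorphism of the (discrete) topological group `Π^tp_Y`.
[cite: MochizukiEtTh2009, Prop 2.14(iii) p.49] -/
noncomputable def autYCont (σ : K ≃* K) : (toy 1).PiY ≃ₜ* (toy 1).PiY :=
  { autY σ with
    continuous_toFun := continuous_of_discreteTopology
    continuous_invFun := continuous_of_discreteTopology }

/-- The automorphism `(u, y) ↦ (u, autY σ y)` of the envelope `Π^tp_Y[μ_1] = μ_1 ⋊ Π^tp_Y`.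
[cite: MochizukiEtTh2009, Def 2.13(ii) p.48] -/
noncomputable def autEnv (σ : K ≃* K) : (toy 1).env ≃ₜ* (toy 1).env :=
  { SemidirectProduct.congr (MulEquiv.refl _) (autY σ)
      (fun _ => MulEquiv.ext fun _ => Subsingleton.elim _ _) with
    continuous_toFun := by
      haveI := discreteTopology_env 1; exact continuous_of_discreteTopology
    continuous_invFun := by
      haveI := discreteTopology_env 1; exact continuous_of_discreteTopology }

/-- The projection to `Π^tp_X` of an element of the envelope. [cite: MochizukiEtTh2009, Def 2.10 p.44] -/
def prP (y : (toy 1).env) : P := ((y.right : (toy 1).PiY) : P)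

/-- `prP (s^alg y) = y`. [cite: MochizukiEtTh2009, Def 2.13(i) p.47] -/
theorem prP_sAlg (y : (toy 1).PiYdd) : prP ((toy 1).toThetaEnvData.sAlg y) = y := rfl

/-- `prP (s^Θ y) = y` (at level `1` the theta section is the algebraic one).
[cite: MochizukiEtTh2009, Def 2.13(i) p.47] -/
theorem prP_sTheta (y : (toy 1).PiYdd) :
    prP ((toy 1).toThetaEnvData.sTheta (one_mem_thetaCocycles 1) y) = y := rfl

/-- `prP (autEnv σ x) = autP σ (prP x)`. [cite: MochizukiEtTh2009, Def 2.13(ii) p.48] -/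
theorem prP_autEnv (σ : K ≃* K) (x : (toy 1).env) : prP (autEnv σ x) = autP σ (prP x) := rfl

/-- If `σ` fixes the `a`-coordinate and is an involution, `autEnv σ` maps the image of the theta
section onto itself. [cite: MochizukiEtTh2009, Def 2.13(ii) p.48] -/
theorem map_autEnv_range_sTheta (σ : K ≃* K) (hσ : ∀ k : K, (σ k).1 = k.1)
    (hσ2 : ∀ k : K, σ (σ k) = k) :
    ((toy 1).toThetaEnvData.sTheta (one_mem_thetaCocycles 1)).range.map
        (autEnv σ).toMulEquiv.toMonoidHom =
      ((toy 1).toThetaEnvData.sTheta (one_mem_thetaCocycles 1)).range := by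
  have key : ∀ y : (toy 1).PiYdd, ∃ y' : (toy 1).PiYdd,
      autEnv σ ((toy 1).toThetaEnvData.sTheta (one_mem_thetaCocycles 1) y) =
        (toy 1).toThetaEnvData.sTheta (one_mem_thetaCocycles 1) y' := by
    intro y
    have hy : ((y : P).1 = 1) ∧ (y : P).2.1 = 1 := by
      have := y.2
      rw [mem_PiYdd_iff'] at this
      exact ⟨this.2, this.1⟩
    refine ⟨⟨autP σ y, ?_⟩, SemidirectProduct.ext (Subsingleton.elim _ _) (Subtype.ext rfl)⟩
    rw [mem_PiYdd_iff']
    obtain ⟨⟨z, k⟩, _⟩ := y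
    exact ⟨(hσ k).trans hy.2, hy.1⟩
  ext x
  constructor
  · rintro ⟨_, ⟨y, rfl⟩, rfl⟩
    obtain ⟨y', hy'⟩ := key y
    exact ⟨y', hy'.symm⟩
  · rintro ⟨y, rfl⟩
    obtain ⟨y', hy'⟩ := key y
    refine ⟨_, ⟨y', rfl⟩, ?_⟩
    change autEnv σ _ = _
    have hback : autEnv σ (autEnv σ ((toy 1).toThetaEnvData.sTheta (one_mem_thetaCocycles 1) y)) =
        (toy 1).toThetaEnvData.sTheta (one_mem_thetaCocycles 1) y := by
      refine SemidirectProduct.ext (Subsingleton.elim _ _) (Subtype.ext ?_)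
      change prP _ = prP _
      rw [prP_autEnv, prP_autEnv, prP_sTheta]
      obtain ⟨⟨z, k⟩, _⟩ := y
      change ((z, σ (σ k)) : P) = (z, k)
      rw [hσ2]
    rw [hy'] at hback
    exact hback

end Toy

end RigidData

end Literature.AnabelianGeometry.EtaleTheta
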